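import Summits.QuantumFields.BalabanUV.T4Continuum.Support.UrsellMayerLog
import Literature.Probability.LatticeModels.ClusterExpansionKPBound

/-!
# NE5 ∕ U3, route P2 — R-IDENT part (B): the Kotecký–Preiss truncated functional `Φᵀ(K)` (Möbius transform of the logarithm)
# IS the ordered Ursell series restricted to the tuples whose support is EXACTLY `K`

Cell `pub-balaban`, unit `b2b-balaban-t4-ne5-p2` (T⁴ fan-out NE5 ∕ node U3, PROVER seat P2 «polymer-activity Lipschitz ∕
Kotecký–Preiss route», lineage gen 18; journal CLAIM «R-IDENT»).  Summits-side new work under the LEAN PLACEMENT RULE (our generic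
bridge lemmas; NOT a Literature module, NOT a statement about any Bałaban paper).  HONEST FRAMING: rung (B)+1 of the FINITE-VOLUME
T⁴ continuum programme — NOT infinite volume, NOT a mass gap, NOT the Clay problem, NOT a proof of NE5.  HONEST DEPENDENCY (cell
line, verbatim): continuum YM on T⁴ ⇐ BetaPertH ∧ nine spine estimates (0/9 proved); BetaPertH ⇐ (D1) ∧ (D4) ∧ CAP+tail; G-an2-4
gates asym, D1 and NE2/3/4.

WHAT («R-IDENT» proper, journal l.6827: route P2's `ClusterRep.outB = Σ_{K ∈ clus X} Φᵀ(K)` versus the model of record's ordered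
form of [Balaban1988RG2Cluster] (2.13)).  For a reflexive symmetric hard core `inc` on a type `α`, activities `v : α → ℂ`, and a
finite set `K` of polymers whose ordered Ursell series converges absolutely (the hypothesis of `UrsellMayerLog.polymerLogZ_finset_eq_tsum`,
`Summable (n ↦ UKabs inc v K (n+1) ∕ (n+1)!)`):
* §1 `Uexact inc v S n := Σ_{Z ∈ S^{Fin n}, image Z = S} ρᵀ(Z)·Π v(Z m)` (the tuples SUPPORTED EXACTLY on `S`) and the finite
  SUPPORT DECOMPOSITION `UK inc v B n = Σ_{S ⊆ B} Uexact inc v S n`;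
* §2 MÖBIUS INVERSION on the Boolean lattice in the direction `μ ∘ ζ = δ` (from the tree's
  `Literature.Probability.LatticeModels.sum_powerset_neg_one_pow_card_sdiff_ite_subset`): `Σ_{B ⊆ K} (−1)^{#(K∖B)} Σ_{S ⊆ B} g S = g K`;
* §3 **`truncatedWeight_eq_tsum_exact`** ∕ **`hasSum_truncatedWeight_exact`**:
  `truncatedWeight inc v K = Σ' n, (1∕(n+1)!)·Σ_{Z ∈ K^{Fin (n+1)}, image Z = K} ρᵀ(Z)·Π v(Z m)` — [KP86]'s `Φᵀ(K)` (the tree's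
  `truncatedWeight`, (3) of Kotecký–Preiss: Möbius transform of the continuous-branch logarithm) equals the classical truncated
  function of the cluster expansion summed over the ordered tuples with support exactly `K` (Mayer's theorem of part (A2) for every
  `B ⊆ K`, then §2); absolute convergence of the right side (`summable_norm_Uexact_div`).
This closes the generic half of R-IDENT; the wiring on the carriers' domain geometry (route P2's `DomainGeometry.clusterRep` versus
`B13StepTermFamily.out` over `B13StepTermSocket.labelsIndexing`) is part (C).  No smallness beyond the displayed absolute
convergence; no Bałaban object.  0 sorry; axioms ⊆ {propext, Classical.choice, Quot.sound}.  References (FORM only): Kotecký–Preiss,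
CMP 103 (1986) (2)–(3); Friedli–Velenik, *Statistical Mechanics of Lattice Systems* (CUP 2017) §5.3–§5.4; G.-C. Rota, Z.
Wahrscheinlichkeitstheorie 2 (1964) 340–368 (Möbius inversion).
-/

noncomputable section

open Finset Filter Topology
open scoped BigOperators

namespace Summit.QuantumFields.BalabanUV.T4Continuum.UrsellMayerSeries

open Literature.Probability.LatticeModels (polymerLogZ truncatedWeight sum_powerset_neg_one_pow_card_sdiff_ite_subset)

variable {α : Type*} [DecidableEq α] (inc : α → α → Prop) [DecidableRel inc] (v : α → ℂ)

/-! ## §1 Tuples with exact support and the support decomposition of the level sums -/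

/-- [folklore] LEVEL `n` OF THE ORDERED SERIES RESTRICTED TO EXACT SUPPORT `S`: `Σ_{Z ∈ S^{Fin n}, image Z = S} ρᵀ(Z)·Π v(Z m)`. -/
def Uexact (S : Finset α) (n : ℕ) : ℂ :=
  ∑ Z ∈ (Fintype.piFinset fun _ : Fin n => S) with Finset.univ.image Z = S, (ursT inc Z : ℂ) * ∏ m, v (Z m)

/-- [folklore] ITS ABSOLUTE VERSION. -/
def UexactAbs (S : Finset α) (n : ℕ) : ℝ :=
  ∑ Z ∈ (Fintype.piFinset fun _ : Fin n => S) with Finset.univ.image Z = S, |(ursT inc Z : ℝ)| * ∏ m, ‖v (Z m)‖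

/-- [folklore] `‖Uexact S n‖ ≤ UexactAbs S n ≤ UKabs S n`. -/
theorem norm_Uexact_le (S : Finset α) (n : ℕ) : ‖Uexact inc v S n‖ ≤ UKabs inc v S n := by
  unfold Uexact UKabs
  refine (norm_sum_le _ _).trans ?_
  refine le_trans (Finset.sum_le_sum fun Z _ => ?_) (Finset.sum_le_sum_of_subset_of_nonneg (Finset.filter_subset _ _)
    fun Z _ _ => mul_nonneg (abs_nonneg _) (Finset.prod_nonneg fun _ _ => norm_nonneg _))
  rw [norm_mul, Complex.norm_intCast, norm_prod]

/-- [folklore] The tuples of `B` with image exactly `S ⊆ B` are the tuples of `S` with image exactly `S`. -/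
theorem filter_image_eq_piFinset {B S : Finset α} (hSB : S ⊆ B) (n : ℕ) :
    ((Fintype.piFinset fun _ : Fin n => B).filter fun Z => Finset.univ.image Z = S) =
      (Fintype.piFinset fun _ : Fin n => S).filter fun Z => Finset.univ.image Z = S := by
  ext Z
  simp only [Finset.mem_filter, Fintype.mem_piFinset]
  constructor
  · rintro ⟨-, hZ⟩
    exact ⟨fun m => hZ ▸ Finset.mem_image_of_mem Z (Finset.mem_univ m), hZ⟩
  · rintro ⟨hZS, hZ⟩
    exact ⟨fun m => hSB (hZS m), hZ⟩

/-- [folklore] **SUPPORT DECOMPOSITION**: `UK inc v B n = Σ_{S ⊆ B} Uexact inc v S n` (group the tuples of `B` by their image). -/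
theorem UK_eq_sum_Uexact (B : Finset α) (n : ℕ) : UK inc v B n = ∑ S ∈ B.powerset, Uexact inc v S n := by
  unfold UK Uexact
  rw [← Finset.sum_fiberwise_of_maps_to (s := Fintype.piFinset fun _ : Fin n => B) (t := B.powerset)
    (g := fun Z : Fin n → α => Finset.univ.image Z) (fun Z hZ => Finset.mem_powerset.2 fun a ha => by
      obtain ⟨m, -, rfl⟩ := Finset.mem_image.1 ha
      exact Fintype.mem_piFinset.1 hZ m)]
  refine Finset.sum_congr rfl fun S hS => ?_
  rw [filter_image_eq_piFinset (Finset.mem_powerset.1 hS) n]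

omit [DecidableEq α] in
/-- [folklore] MONOTONICITY of the absolute level sums in the polymer set. -/
theorem UKabs_mono {B K : Finset α} (hBK : B ⊆ K) (n : ℕ) : UKabs inc v B n ≤ UKabs inc v K n := by
  unfold UKabs
  exact Finset.sum_le_sum_of_subset_of_nonneg (Fintype.piFinset_subset _ _ fun _ => hBK)
    fun Z _ _ => mul_nonneg (abs_nonneg _) (Finset.prod_nonneg fun _ _ => norm_nonneg _)

omit [DecidableEq α] in
/-- [folklore] Absolute convergence of the ordered series of `K` passes to every `B ⊆ K`. -/
theorem summable_UKabs_div_of_subset {B K : Finset α} (hBK : B ⊆ K)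
    (h : Summable fun n => UKabs inc v K (n + 1) / ((n + 1).factorial : ℝ)) :
    Summable fun n => UKabs inc v B (n + 1) / ((n + 1).factorial : ℝ) :=
  Summable.of_nonneg_of_le (fun n => div_nonneg (UKabs_nonneg inc v B (n + 1)) (Nat.cast_nonneg _))
    (fun n => div_le_div_of_nonneg_right (UKabs_mono inc v hBK (n + 1)) (Nat.cast_nonneg _)) h

/-- [folklore] The exact-support series of `S ⊆ K` converges absolutely under the hypothesis for `K`. -/
theorem summable_norm_Uexact_div {S K : Finset α} (hSK : S ⊆ K)
    (h : Summable fun n => UKabs inc v K (n + 1) / ((n + 1).factorial : ℝ)) :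
    Summable fun n => ‖Uexact inc v S (n + 1) / ((n + 1).factorial : ℂ)‖ := by
  refine Summable.of_nonneg_of_le (fun _ => norm_nonneg _) (fun n => ?_) (summable_UKabs_div_of_subset inc v hSK h)
  rw [norm_div, Complex.norm_natCast]
  exact div_le_div_of_nonneg_right (norm_Uexact_le inc v S (n + 1)) (Nat.cast_nonneg _)

/-! ## §2 Möbius inversion on the Boolean lattice (`μ ∘ ζ = δ`) -/

omit [DecidableRel inc] in
/-- [folklore] **MÖBIUS INVERSION**: `Σ_{B ⊆ K} (−1)^{#(K ∖ B)} Σ_{S ⊆ B} g S = g K` (from the tree's up-set indicator transform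
`sum_powerset_neg_one_pow_card_sdiff_ite_subset`). -/
theorem sum_powerset_neg_one_pow_mul_sum_powerset {M : Type*} [CommRing M] (g : Finset α → M) (K : Finset α) :
    ∑ B ∈ K.powerset, (-1 : M) ^ (K \ B).card * ∑ S ∈ B.powerset, g S = g K := by
  -- insert the indicator `1[S ⊆ B]` and let `S` range over `K.powerset`
  have hinner : ∀ B ∈ K.powerset, ∑ S ∈ B.powerset, g S = ∑ S ∈ K.powerset, (if S ⊆ B then 1 else 0) * g S := by
    intro B hB
    have hBK := Finset.mem_powerset.1 hB
    have hfil : K.powerset.filter (fun S => S ⊆ B) = B.powerset := by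
      ext S
      simp only [Finset.mem_filter, Finset.mem_powerset]
      exact ⟨fun h => h.2, fun h => ⟨h.trans hBK, h⟩⟩
    rw [← hfil, Finset.sum_filter]
    refine Finset.sum_congr rfl fun S _ => ?_
    split_ifs <;> simp
  rw [Finset.sum_congr rfl fun B hB => by rw [hinner B hB, Finset.mul_sum], Finset.sum_comm]
  rw [Finset.sum_congr rfl fun S _ => by
    rw [Finset.sum_congr rfl fun B _ => (mul_assoc _ _ _).symm, ← Finset.sum_mul,
      sum_powerset_neg_one_pow_card_sdiff_ite_subset]]
  rw [Finset.sum_eq_single_of_mem K (Finset.mem_powerset.2 subset_rfl) fun S _ hS => by rw [if_neg hS, zero_mul]]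
  simp

/-! ## §3 `Φᵀ(K)` is the exactly-supported ordered Ursell series -/

/-- [folklore] **R-IDENT (generic): THE TRUNCATED FUNCTIONAL IS THE EXACTLY-SUPPORTED ORDERED URSELL SERIES.**  For a reflexive
symmetric hard core and a finite polymer set `K` whose ordered Ursell series converges absolutely,
`truncatedWeight inc v K = Σ' n, (1∕(n+1)!)·Σ_{Z ∈ K^{Fin (n+1)}, image Z = K} ρᵀ(Z)·Π v(Z m)`. -/
theorem hasSum_truncatedWeight_exact (K : Finset α) (hrefl : ∀ a, inc a a) (hsymm : ∀ a b, inc a b → inc b a)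
    (h : Summable fun n => UKabs inc v K (n + 1) / ((n + 1).factorial : ℝ)) :
    HasSum (fun n => Uexact inc v K (n + 1) / ((n + 1).factorial : ℂ)) (truncatedWeight inc v K) := by
  -- Mayer's theorem on every `B ⊆ K`, with the support decomposition inside
  have hB : ∀ B ∈ K.powerset, HasSum (fun n => (-1 : ℂ) ^ (K \ B).card *
      ∑ S ∈ B.powerset, Uexact inc v S (n + 1) / ((n + 1).factorial : ℂ)) ((-1 : ℂ) ^ (K \ B).card * polymerLogZ inc v B) := by
    intro B hB
    have hBK : B ⊆ K := Finset.mem_powerset.1 hB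
    have hM := hasSum_polymerLogZ_finset inc v B hrefl hsymm (summable_UKabs_div_of_subset inc v hBK h)
    refine (hM.mul_left _).congr_fun fun n => ?_
    rw [UK_eq_sum_Uexact, Finset.sum_div]
  have hsum := hasSum_sum hB
  -- regroup the finite sums by Möbius inversion
  have hre : (fun n => ∑ B ∈ K.powerset, (-1 : ℂ) ^ (K \ B).card *
      ∑ S ∈ B.powerset, Uexact inc v S (n + 1) / ((n + 1).factorial : ℂ)) =
        fun n => Uexact inc v K (n + 1) / ((n + 1).factorial : ℂ) := by
    funext n
    exact sum_powerset_neg_one_pow_mul_sum_powerset (fun S => Uexact inc v S (n + 1) / ((n + 1).factorial : ℂ)) K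
  rw [hre] at hsum
  unfold truncatedWeight
  exact hsum

/-- [folklore] `tsum` form of R-IDENT (generic). -/
theorem truncatedWeight_eq_tsum_exact (K : Finset α) (hrefl : ∀ a, inc a a) (hsymm : ∀ a b, inc a b → inc b a)
    (h : Summable fun n => UKabs inc v K (n + 1) / ((n + 1).factorial : ℝ)) :
    truncatedWeight inc v K = ∑' n, Uexact inc v K (n + 1) / ((n + 1).factorial : ℂ) :=
  (hasSum_truncatedWeight_exact inc v K hrefl hsymm h).tsum_eq.symm

/-- [folklore] **THE KOTECKÝ–PREISS SUM OVER A FAMILY OF SUPPORTS = THE ORDERED SERIES OVER THE TUPLES WITH SUPPORT IN THE FAMILY.**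
For a finite family `𝒦` of polymer sets, each with absolutely convergent ordered series:
`Σ_{K ∈ 𝒦} Φᵀ(K) = Σ' n, (1∕(n+1)!)·Σ_{K ∈ 𝒦} Σ_{Z ∈ K^{Fin (n+1)}, image Z = K} ρᵀ(Z)·Π v(Z m)` (the form in which route P2's
`clusterSum` meets the model of record's level series; part (C) identifies the inner double sum with the sum over covering tuples). -/
theorem hasSum_clusterSum_exact (𝒦 : Finset (Finset α)) (hrefl : ∀ a, inc a a) (hsymm : ∀ a b, inc a b → inc b a)
    (h : ∀ K ∈ 𝒦, Summable fun n => UKabs inc v K (n + 1) / ((n + 1).factorial : ℝ)) :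
    HasSum (fun n => ∑ K ∈ 𝒦, Uexact inc v K (n + 1) / ((n + 1).factorial : ℂ)) (∑ K ∈ 𝒦, truncatedWeight inc v K) :=
  hasSum_sum fun K hK => hasSum_truncatedWeight_exact inc v K hrefl hsymm (h K hK)

end Summit.QuantumFields.BalabanUV.T4Continuum.UrsellMayerSeries

end
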